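import Mathlib

/-!
# R90 · S6 «Ch. 14.1–14.5 stable trace formula» — WAVE 2 helper W2-d: Hecke-continuous functionals are a ℂ-linear family

Supply-side closure lemma for FILE B's `HeckeContinuous X ev ·` text
(`Cruxes/H413/Lines/R90_S6_StableTFSpectralB.lean` §E1, body EXPANDED — Theorems do not import Lines):
if `F φ = ∫ ev φ · d₁ dm₁` and `G φ = ∫ ev φ · d₂ dm₂` with `mᵢ` ATOMLESS Borel measures on the compact chart
`X ⊂ ℂ` and `dᵢ ∈ L¹(mᵢ)`, then `a·F + b·G` is again of this shape.  The (14.5.1) supplier produces each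
absolutely continuous spectral term separately (Arthur's (2.3.4) `M`-terms, the `SJ_M`-brackets); the
dichotomy text `LanglandsDichotomy` wants their `± ½`-combinations.

PROOF.  FILE B puts no finiteness on `mᵢ`, so Radon–Nikodym is not available raw; but an `L¹` density
lives on a σ-finite piece: with `tᵢ := (hdᵢ.aefinStronglyMeasurable).sigmaFiniteSet` the restriction
`mᵢ' := mᵢ|_{tᵢ}` is σ-finite, still atomless, `dᵢ ∈ L¹(mᵢ')`, and `∫ f · dᵢ dmᵢ = ∫ f · dᵢ dmᵢ'` for EVERY
`f` (`dᵢ = 0` a.e. off `tᵢ`).  Then `m := m₁' + m₂'` is σ-finite and atomless, `mᵢ' ≪ m`, and with the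
Radon–Nikodym derivatives `ρᵢ := (∂mᵢ'/∂m).toReal` the density `d := a·ρ₁·d₁ + b·ρ₂·d₂ ∈ L¹(m)` does it
(`integral_rnDeriv_smul`, `integrable_rnDeriv_smul_iff`).

Cell `hodgecm-mathlib`, crux H413 (`stmt-HodgeConjecture-24833`), route of record `HCCMUnconditional`;
programme R90-TF (brief `director/R90-BRIEF.v2.md`), section S6 (base `R90-C14`), seat R90-C14-p03 (g0);
planner RECONCILIATION 15:54:18Z (W2-d → p03), sheet `S6_wave2_targets.v1.R90-C14-plan-g0.lean` :21–:25
(signature verbatim, ns without `.Wave2`), AUDIT S6#W2 (d) CLEAN 15:54:57Z.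
Lane `--supports stmt-HodgeConjecture-24833 --as helper`; ONE public theorem (private lemmas), pure Mathlib,
no definition, no kit, no posited object, no `sorry`.
HONEST LABEL: this file proves no printed global statement; HC_CM is proved only modulo the 7 printed
citations (2 remaining named inputs: hLiu418 = stmt-HodgeConjecture-24832, h413 = stmt-HodgeConjecture-24833)
until rung 0 closes.
-/

set_option autoImplicit false
-- the mandated namespace repeats the single-problem summit's segment (`HodgeConjecture.HodgeConjecture`)
set_option linter.dupNamespace false

open MeasureTheory Filter Topology

namespace Summit.HodgeConjecture.HodgeConjecture.R90.S6

section SigmaFinite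

variable {α : Type*} [MeasurableSpace α]

/-- **σ-finite normalisation.** An atomless measure `m` with an `L¹` density `d` may be replaced by a
σ-FINITE atomless measure carrying the same density and the same functional `f ↦ ∫ f · d`. -/
private theorem exists_sigmaFinite_sameFunctional {m : Measure α} {d : α → ℂ}
    (hm : ∀ x, m {x} = 0) (hd : Integrable d m) :
    ∃ m' : Measure α, SigmaFinite m' ∧ (∀ x, m' {x} = 0) ∧ Integrable d m' ∧
      ∀ f : α → ℂ, ∫ x, f x * d x ∂m = ∫ x, f x * d x ∂m' := by
  have hfs := hd.aefinStronglyMeasurable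
  refine ⟨m.restrict hfs.sigmaFiniteSet, inferInstance, ?_, hd.restrict, ?_⟩
  · intro x
    exact nonpos_iff_eq_zero.mp ((Measure.restrict_apply_le _ {x}).trans_eq (hm x))
  · intro f
    -- `d = 0` a.e. off the σ-finite set, so restricting does not change `∫ f · d`
    have h0 : ∀ᵐ x ∂m, x ∈ hfs.sigmaFiniteSetᶜ → d x = 0 :=
      (ae_restrict_iff' hfs.measurableSet.compl).mp hfs.ae_eq_zero_compl
    refine (setIntegral_eq_integral_of_ae_compl_eq_zero ?_).symm
    filter_upwards [h0] with x hx hxt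
    rw [hx hxt, mul_zero]

/-- **Common dominating measure.** Two σ-finite atomless pairs `(m₁, d₁)`, `(m₂, d₂)` and scalars `a, b`:
on `m := m₁ + m₂` the density `a·(∂m₁/∂m)·d₁ + b·(∂m₂/∂m)·d₂` represents `a·∫ f d₁ dm₁ + b·∫ f d₂ dm₂`
for every `f` with `f·dᵢ ∈ L¹(mᵢ)` (Radon–Nikodym). -/
private theorem exists_add_of_sigmaFinite (a b : ℂ) {m₁ m₂ : Measure α} [SigmaFinite m₁] [SigmaFinite m₂]
    {d₁ d₂ : α → ℂ} (h₁ : ∀ x, m₁ {x} = 0) (h₂ : ∀ x, m₂ {x} = 0)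
    (hd₁ : Integrable d₁ m₁) (hd₂ : Integrable d₂ m₂) :
    ∃ (m : Measure α) (d : α → ℂ), (∀ x, m {x} = 0) ∧ Integrable d m ∧
      ∀ f : α → ℂ, Integrable (fun x => f x * d₁ x) m₁ → Integrable (fun x => f x * d₂ x) m₂ →
        a * (∫ x, f x * d₁ x ∂m₁) + b * (∫ x, f x * d₂ x ∂m₂) = ∫ x, f x * d x ∂m := by
  have hac₁ : m₁ ≪ m₁ + m₂ := Measure.AbsolutelyContinuous.rfl.add_right m₂
  have hac₂ : m₂ ≪ m₁ + m₂ := Measure.AbsolutelyContinuous.rfl.add_right' m₁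
  refine ⟨m₁ + m₂,
    fun x => a * (((m₁.rnDeriv (m₁ + m₂) x).toReal : ℂ) * d₁ x)
      + b * (((m₂.rnDeriv (m₁ + m₂) x).toReal : ℂ) * d₂ x), ?_, ?_, ?_⟩
  · intro x
    rw [Measure.add_apply, h₁ x, h₂ x, add_zero]
  · have i₁ : Integrable (fun x => (m₁.rnDeriv (m₁ + m₂) x).toReal • d₁ x) (m₁ + m₂) :=
      (integrable_rnDeriv_smul_iff hac₁).mpr hd₁
    have i₂ : Integrable (fun x => (m₂.rnDeriv (m₁ + m₂) x).toReal • d₂ x) (m₁ + m₂) :=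
      (integrable_rnDeriv_smul_iff hac₂).mpr hd₂
    simp only [Complex.real_smul] at i₁ i₂
    exact (i₁.const_mul a).add (i₂.const_mul b)
  · intro f hf₁ hf₂
    have j₁ : Integrable (fun x => (m₁.rnDeriv (m₁ + m₂) x).toReal • (f x * d₁ x)) (m₁ + m₂) :=
      (integrable_rnDeriv_smul_iff hac₁).mpr hf₁
    have j₂ : Integrable (fun x => (m₂.rnDeriv (m₁ + m₂) x).toReal • (f x * d₂ x)) (m₁ + m₂) :=
      (integrable_rnDeriv_smul_iff hac₂).mpr hf₂
    rw [← integral_rnDeriv_smul hac₁, ← integral_rnDeriv_smul hac₂,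
      ← integral_const_mul, ← integral_const_mul, ← integral_add (j₁.const_mul a) (j₂.const_mul b)]
    refine integral_congr_ae (Eventually.of_forall fun x => ?_)
    simp only [Complex.real_smul]
    ring

end SigmaFinite

/-- The two steps assembled on a compact chart with continuous test functions `ev φ`
(bounded × `L¹` is `L¹`, so the Radon–Nikodym step applies to `f := ev φ`). -/
private theorem exists_linear_combination {X : Type*} [TopologicalSpace X] [CompactSpace X]
    [MeasurableSpace X] [OpensMeasurableSpace X] {Φ : Type*} (ev : Φ → C(X, ℂ)) (a b : ℂ)
    {m₁ m₂ : Measure X} {d₁ d₂ : X → ℂ}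
    (h₁ : ∀ x, m₁ {x} = 0) (hd₁ : Integrable d₁ m₁) (h₂ : ∀ x, m₂ {x} = 0) (hd₂ : Integrable d₂ m₂) :
    ∃ (m : Measure X) (d : X → ℂ), (∀ x, m {x} = 0) ∧ Integrable d m ∧
      ∀ φ, a * (∫ x, ev φ x * d₁ x ∂m₁) + b * (∫ x, ev φ x * d₂ x ∂m₂) = ∫ x, ev φ x * d x ∂m := by
  obtain ⟨m₁', hσ₁, h₁', hd₁', hF₁⟩ := exists_sigmaFinite_sameFunctional h₁ hd₁
  obtain ⟨m₂', hσ₂, h₂', hd₂', hF₂⟩ := exists_sigmaFinite_sameFunctional h₂ hd₂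
  obtain ⟨m, d, hm, hd, hlin⟩ := exists_add_of_sigmaFinite a b h₁' h₂' hd₁' hd₂'
  refine ⟨m, d, hm, hd, fun φ => ?_⟩
  rw [hF₁ (fun x => ev φ x), hF₂ (fun x => ev φ x)]
  exact hlin _
    (hd₁'.bdd_mul (ev φ).continuous.aestronglyMeasurable
      (Eventually.of_forall fun x => (ev φ).norm_coe_le_norm x))
    (hd₂'.bdd_mul (ev φ).continuous.aestronglyMeasurable
      (Eventually.of_forall fun x => (ev φ).norm_coe_le_norm x))

/-- **(W2-d) Hecke-continuous functionals are a ℂ-linear family** [Rogawski1990, §10.3 (10.3.2)–(10.3.3)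
p. 159: «Similarly, (10.3.2) and (10.3.3) extend to linear functionals on C … an absolutely continuous
measure on X»; §14.5 (14.5.1) p. 240; Arthur's continuity of the `M`-terms, §2.3 (2.3.4) p. 18]: the
EXPANDED `HeckeContinuous X ev ·` text of FILE B — «`F φ = ∫ ev φ · d dm` for an atomless Borel measure `m`
on the compact chart `X ⊂ ℂ` and a density `d ∈ L¹(m)`» — is closed under `φ ↦ a · F φ + b · G φ` for all
`a b : ℂ`.  Road: σ-finite normalisation of each pair (an `L¹` density lives on a σ-finite piece), common
dominating measure `m₁' + m₂'`, Radon–Nikodym densities.  Junction: hypotheses and conclusion are B's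
`HeckeContinuous` body token-for-token (sheet `S6_wave2_targets.v1` :21–:25).
(print: Rogawski1990, §10.3 p. 159; §14.5 p. 240; §2.3 p. 18) -/
theorem heckeContinuous_linear (X : TopologicalSpace.Compacts ℂ) {Φ : Type} (ev : Φ → C(X, ℂ)) (F G : Φ → ℂ) (a b : ℂ)
    (hF : ∃ (m : Measure X) (d : X → ℂ), (∀ x : X, m {x} = 0) ∧ Integrable d m ∧ ∀ φ, F φ = ∫ x, ev φ x * d x ∂m)
    (hG : ∃ (m : Measure X) (d : X → ℂ), (∀ x : X, m {x} = 0) ∧ Integrable d m ∧ ∀ φ, G φ = ∫ x, ev φ x * d x ∂m) :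
    ∃ (m : Measure X) (d : X → ℂ), (∀ x : X, m {x} = 0) ∧ Integrable d m ∧ ∀ φ, a * F φ + b * G φ = ∫ x, ev φ x * d x ∂m := by
  obtain ⟨m₁, d₁, h₁, hd₁, hF⟩ := hF
  obtain ⟨m₂, d₂, h₂, hd₂, hG⟩ := hG
  obtain ⟨m, d, hm, hd, hlin⟩ := exists_linear_combination ev a b h₁ hd₁ h₂ hd₂
  refine ⟨m, d, hm, hd, fun φ => ?_⟩
  rw [hF φ, hG φ]
  exact hlin φ

end Summit.HodgeConjecture.HodgeConjecture.R90.S6
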